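/-
Copyright (c) 2026 the pub-hodgecm-mathlib formalisation cell (harness21).  Prover seat hodgecm-mathlib-K2E5-p11 (g2): Track B «K2-LIT», engine E3, line (ii′)
«H-side central germ expansion», leaf (E) `sig_K2E3CentralGermExpansionExistence`, sub-leaf (RAO_z), brick «RAO-CONV_z» (cut by K2E3-p23 (g2) 2026-09-04), FILE A.
-/
import Literature.NumberTheory.Automorphic.UnitaryTwoUnipotentClasses        -- ★ `B₀_two_apply`, `n(t)`, `d(z) = diag(z, (σz)⁻¹)`, `exists_units_coe_eq_lineUnipotent`
import Literature.NumberTheory.Automorphic.UnitaryTwoSplitDictionary          -- ★ `SplitDictionary.rel_of_mem_unitaryGroupOfForm_two` (entry relations of a unitary 2×2 matrix)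
import Literature.NumberTheory.Automorphic.UnitaryLatticeTreeDefs             -- ★ `IsIntMatrix`
import HarnessLib

/-!
# Upper-triangular unitary `2 × 2` matrices against the line transvection `n(t)` — the field-level §1 of Ranga Rao's convergence for `U(1,1)`

Rank-one (`N = 2`) twin of §1 of ★ p849314 `Literature/NumberTheory/Rogawski1990/UnipotentOrbitalIntegralConvergenceTransvectionCM.lean` (there `N = 3`, corner
transvection `1 + t E₀₂`).  Over a field `K` with an involution `σ` and the quasi-split hermitian form `J₀ = antidiag(1, 1)`:

* `diag_rel_of_upper_mem_unitaryGroupOfForm_two` — an upper-triangular `h ∈ U(σ, J₀)` has `σ(h₀₀)·h₁₁ = 1`;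
* `coe_conj_lineUnipotent_of_apply_one_zero_eq_zero` — such an `h` conjugates `n(t) = !![1, t; 0, 1]` to `n(t·h₀₀·σh₀₀)` (the torus weight on the root line);
* `lineCriterion_conj_diagonal_iff` — the commutation criterion with `n(t)` (`g₁₀ = 0 ∧ g₀₀ = g₁₁`, ★ `mul_lineUnipotent_eq_lineUnipotent_mul_iff`) is invariant under
  conjugation by an invertible diagonal matrix;
* `torusEltTwo_conj_eq_of_apply_one_zero_eq_zero`, `isIntMatrix_torusEltTwo_conj_of_apply_one_zero_eq_zero` — `d(ϖ) g d(ϖ)⁻¹ = (g₀₀, ϖσϖ·g₀₁; 0, g₁₁)` for upper-triangular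
  `g`, so `Ad d(ϖ)` improves integrality on the centraliser of `n(t)` when `|ϖ|, |σϖ| ≤ 1`;
* `exists_units_coe_eq_diagonal₂`, `diagonal_mem_unitaryGroupOfForm_two_iff`, `isIntMatrix_lineUnipotent` — bookkeeping.

These are the entry computations behind the Iwasawa covering `{y ∣ y u y⁻¹ ∈ C} ⊆ ⋃ₘ K d(ϖ)^m Z(u)` of the orbit of a regular unipotent `u ∼ n(t₀)` of `U(1,1)(L_w ∕ L⁺_v)`
(FILE B `UnitaryTwoOneCentralUnipotentOrbitFinitenessCM`).  THEOREMS ONLY; count-neutral ★ brick `--supports stmt-HodgeConjecture-24833`.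
HONEST LABEL: HC_CM is proved only modulo the 7 printed citations (2 remaining named inputs: hLiu418 = stmt-HodgeConjecture-24832, h413 = stmt-HodgeConjecture-24833)
until rung 0 closes.

## References
* [Rogawski1990] J. D. Rogawski, *Automorphic Representations of Unitary Groups in Three Variables*, Ann. of Math. Stud. 123 (1990): §1.10 p. 9 (`B = MN`, `n(t)`, `d(z)`),
  §3.9 p. 32 (centralisers of unipotent elements).
* [Rao1972] R. Ranga Rao, *Orbital integrals in reductive groups*, Ann. of Math. (2) 96 (1972) 505–510.
* [PlatonovRapinchuk1994] V. Platonov, A. Rapinchuk, *Algebraic Groups and Number Theory* (1994), §3.3 (integral points of `GL_n` over a local field).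
-/

set_option autoImplicit false

noncomputable section

open scoped Matrix MatrixGroups Valued WithZero
open Matrix

namespace Literature.NumberTheory.Automorphic.UnitaryGroup

open Literature.NumberTheory.Automorphic.HermitianLattice Literature.NumberTheory.Automorphic.UnitaryLatticeTree

/-! ## §1 Field level: upper-triangular unitary matrices against `n(t)` -/

section Field

variable {K : Type*} [Field K] (σ : K →+* K)

/-- **The diagonal of an upper-triangular unitary `2 × 2` matrix** (form `J₀ = antidiag(1,1)`): `σ(h₀₀)·h₁₁ = 1` — read `B₀(h e₀, h e₁) = B₀(e₀, e₁) = 1` with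
`h e₀ = h₀₀ e₀` (★ `SplitDictionary.rel_of_mem_unitaryGroupOfForm_two`, second relation, at `h₁₀ = 0`). [cite: Rogawski1990, §1.10 p. 9] -/
theorem diag_rel_of_upper_mem_unitaryGroupOfForm_two {h : GL (Fin 2) K} (hh : h ∈ unitaryGroupOfForm σ ((StdForm.antidiagonal 2).over K))
    (h10 : (h : Matrix (Fin 2) (Fin 2) K) 1 0 = 0) :
    σ ((h : Matrix (Fin 2) (Fin 2) K) 0 0) * (h : Matrix (Fin 2) (Fin 2) K) 1 1 = 1 := by
  have e := (SplitDictionary.rel_of_mem_unitaryGroupOfForm_two σ hh).2.1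
  rwa [h10, map_zero, zero_mul, add_zero] at e

/-- **An upper-triangular unitary matrix conjugates `n(t)` to `n(t·h₀₀·σh₀₀)`**: for `h ∈ U(σ, J₀)` with `h₁₀ = 0`, `h n(t) h⁻¹ = n(t h₀₀ σ(h₀₀))` (compare
`h n(t) = n(s) h` entrywise, `s = t h₀₀ σh₀₀`, using `σ(h₀₀) h₁₁ = 1`). [cite: Rogawski1990, §1.10 p. 9; §3.9 p. 32] -/
theorem coe_conj_lineUnipotent_of_apply_one_zero_eq_zero {t : K} {u h : GL (Fin 2) K}
    (hu : (u : Matrix (Fin 2) (Fin 2) K) = !![1, t; 0, 1])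
    (hh : h ∈ unitaryGroupOfForm σ ((StdForm.antidiagonal 2).over K))
    (h10 : (h : Matrix (Fin 2) (Fin 2) K) 1 0 = 0) :
    ((h * u * h⁻¹ : GL (Fin 2) K) : Matrix (Fin 2) (Fin 2) K) =
      !![1, t * (h : Matrix (Fin 2) (Fin 2) K) 0 0 * σ ((h : Matrix (Fin 2) (Fin 2) K) 0 0); 0, 1] := by
  have hrel := diag_rel_of_upper_mem_unitaryGroupOfForm_two σ hh h10
  obtain ⟨ns, hns, -⟩ := exists_units_coe_eq_lineUnipotent (t * (h : Matrix (Fin 2) (Fin 2) K) 0 0 * σ ((h : Matrix (Fin 2) (Fin 2) K) 0 0))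
  -- `h n(t) = n(s) h` as matrices
  have key : (h : Matrix (Fin 2) (Fin 2) K) * (u : Matrix (Fin 2) (Fin 2) K) = (ns : Matrix (Fin 2) (Fin 2) K) * (h : Matrix (Fin 2) (Fin 2) K) := by
    rw [hu, hns]
    ext i j
    fin_cases i <;> fin_cases j
    · simp [Matrix.mul_apply, Fin.sum_univ_two, h10]
    · simp only [Matrix.mul_apply, Fin.sum_univ_two, Matrix.of_apply, Matrix.cons_val', Matrix.cons_val_zero, Matrix.cons_val_one,
        Matrix.empty_val', Matrix.cons_val_fin_one, Fin.zero_eta, Fin.isValue, Fin.mk_one, mul_one, one_mul]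
      have e : t * (h : Matrix (Fin 2) (Fin 2) K) 0 0 * σ ((h : Matrix (Fin 2) (Fin 2) K) 0 0) * (h : Matrix (Fin 2) (Fin 2) K) 1 1 =
          (h : Matrix (Fin 2) (Fin 2) K) 0 0 * t := by
        rw [mul_assoc, hrel, mul_one, mul_comm]
      rw [e, add_comm]
    · simp [Matrix.mul_apply, Fin.sum_univ_two, h10]
    · simp [Matrix.mul_apply, Fin.sum_univ_two, h10]
  have hGL : h * u = ns * h := Units.ext (by rw [Units.val_mul, Units.val_mul]; exact key)
  rw [hGL, mul_inv_cancel_right, hns]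

/-- A diagonal invertible `2 × 2` matrix `diag(α, β)` with its inverse `diag(α⁻¹, β⁻¹)`, as a unit of `M₂(K)` (the diagonal torus of `GL₂`). [cite: Rogawski1990, §1.10 p. 9] -/
theorem exists_units_coe_eq_diagonal₂ {α β : K} (hα : α ≠ 0) (hβ : β ≠ 0) :
    ∃ d : GL (Fin 2) K, (d : Matrix (Fin 2) (Fin 2) K) = Matrix.diagonal ![α, β] ∧
      ((d⁻¹ : GL (Fin 2) K) : Matrix (Fin 2) (Fin 2) K) = Matrix.diagonal ![α⁻¹, β⁻¹] := by
  have h1 : Matrix.diagonal ![α, β] * Matrix.diagonal ![α⁻¹, β⁻¹] = 1 := by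
    rw [Matrix.diagonal_mul_diagonal, ← Matrix.diagonal_one]
    congr 1; funext i; fin_cases i <;> simp [mul_inv_cancel₀ hα, mul_inv_cancel₀ hβ]
  have h2 : Matrix.diagonal ![α⁻¹, β⁻¹] * Matrix.diagonal ![α, β] = 1 := by
    rw [Matrix.diagonal_mul_diagonal, ← Matrix.diagonal_one]
    congr 1; funext i; fin_cases i <;> simp [inv_mul_cancel₀ hα, inv_mul_cancel₀ hβ]
  exact ⟨⟨_, _, h1, h2⟩, rfl, rfl⟩

/-- Entries of a diagonal conjugate: `(D g D⁻¹)_{ij} = D_i g_{ij} D_j⁻¹` for `D = diag(α, β)`. [folklore] -/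
private theorem diagonal₂_conj_apply {α β : K} {d : GL (Fin 2) K} (hd : (d : Matrix (Fin 2) (Fin 2) K) = Matrix.diagonal ![α, β])
    (hd' : ((d⁻¹ : GL (Fin 2) K) : Matrix (Fin 2) (Fin 2) K) = Matrix.diagonal ![α⁻¹, β⁻¹]) (g : Matrix (Fin 2) (Fin 2) K) (i j : Fin 2) :
    ((d : Matrix (Fin 2) (Fin 2) K) * g * ((d⁻¹ : GL (Fin 2) K) : Matrix (Fin 2) (Fin 2) K)) i j = ![α, β] i * g i j * (![α, β] j)⁻¹ := by
  rw [hd, hd']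
  fin_cases i <;> fin_cases j <;> simp [Matrix.mul_apply, Matrix.diagonal]

/-- **A diagonal matrix `diag(α, β)` is unitary for `J₀ = antidiag(1,1)` iff `σ(α)·β = 1` and `σ(β)·α = 1`** (`B₀(d e₀, d e₁) = σα·β`, `B₀(d e₁, d e₀) = σβ·α`,
`B₀(d eᵢ, d eᵢ) = 0`). [cite: Rogawski1990, §1.10 p. 9] -/
theorem diagonal_mem_unitaryGroupOfForm_two_iff {α β : K} {d : GL (Fin 2) K} (hd : (d : Matrix (Fin 2) (Fin 2) K) = Matrix.diagonal ![α, β]) :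
    d ∈ unitaryGroupOfForm σ ((StdForm.antidiagonal 2).over K) ↔ σ α * β = 1 ∧ σ β * α = 1 := by
  rw [mem_unitaryGroupOfForm_antidiagonal_iff, hd]
  have key : ∀ x y : Fin 2 → K,
      B₀ σ 2 ((Matrix.diagonal ![α, β]) *ᵥ x) ((Matrix.diagonal ![α, β]) *ᵥ y) = σ α * β * (σ (x 0) * y 1) + σ β * α * (σ (x 1) * y 0) := by
    intro x y
    rw [B₀_two_apply, Matrix.mulVec_diagonal, Matrix.mulVec_diagonal, Matrix.mulVec_diagonal, Matrix.mulVec_diagonal]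
    simp only [Matrix.cons_val_zero, Matrix.cons_val_one, map_mul]
    ring
  constructor
  · intro h
    have h01 := h (Pi.single 0 1) (Pi.single 1 1)
    have h10 := h (Pi.single 1 1) (Pi.single 0 1)
    rw [key, B₀_two_apply] at h01 h10
    simp at h01 h10
    exact ⟨h01, h10⟩
  · rintro ⟨h1, h2⟩ x y
    rw [key, h1, h2, B₀_two_apply]; ring

/-- **The commutation criterion with `n(t)` is invariant under diagonal conjugation**: for `D = diag(α, β)` invertible, `g₁₀ = 0 ∧ g₀₀ = g₁₁` iff the same holds
for `D g D⁻¹` (the off-diagonal entry is rescaled by `β α⁻¹`, the diagonal ones are unchanged). [cite: Rogawski1990, §3.9 p. 32] -/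
theorem lineCriterion_conj_diagonal_iff {α β : K} {d : GL (Fin 2) K} (hd : (d : Matrix (Fin 2) (Fin 2) K) = Matrix.diagonal ![α, β])
    (hd' : ((d⁻¹ : GL (Fin 2) K) : Matrix (Fin 2) (Fin 2) K) = Matrix.diagonal ![α⁻¹, β⁻¹])
    (hα : α ≠ 0) (hβ : β ≠ 0) (g : Matrix (Fin 2) (Fin 2) K) :
    (g 1 0 = 0 ∧ g 0 0 = g 1 1) ↔
      (((d : Matrix (Fin 2) (Fin 2) K) * g * ((d⁻¹ : GL (Fin 2) K) : Matrix (Fin 2) (Fin 2) K)) 1 0 = 0 ∧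
        ((d : Matrix (Fin 2) (Fin 2) K) * g * ((d⁻¹ : GL (Fin 2) K) : Matrix (Fin 2) (Fin 2) K)) 0 0 =
          ((d : Matrix (Fin 2) (Fin 2) K) * g * ((d⁻¹ : GL (Fin 2) K) : Matrix (Fin 2) (Fin 2) K)) 1 1) := by
  simp only [diagonal₂_conj_apply hd hd']
  have e0 : (![α, β] : Fin 2 → K) 0 = α := rfl
  have e1 : (![α, β] : Fin 2 → K) 1 = β := rfl
  have key : ∀ {c : K}, c ≠ 0 → ∀ x : K, c * x * c⁻¹ = x := fun hc x => by field_simp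
  simp only [e0, e1, mul_eq_zero, inv_eq_zero, hα, hβ, or_false, false_or, key hα, key hβ]

/-- **`d(ϖ)`-conjugation on upper-triangular matrices, entrywise**: for `g` with `g₁₀ = 0`, `d(ϖ) g d(ϖ)⁻¹ = (g₀₀, ϖ σϖ g₀₁; 0, g₁₁)`,
`d(ϖ) = diag(ϖ, (σϖ)⁻¹)`. [cite: Rogawski1990, §1.10 p. 9; §3.9 p. 32] -/
theorem torusEltTwo_conj_eq_of_apply_one_zero_eq_zero {ϖ : K} (hϖ : ϖ ≠ 0)
    {d : GL (Fin 2) K} (hd : (d : Matrix (Fin 2) (Fin 2) K) = Matrix.diagonal ![ϖ, (σ ϖ)⁻¹])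
    (hd' : ((d⁻¹ : GL (Fin 2) K) : Matrix (Fin 2) (Fin 2) K) = Matrix.diagonal ![ϖ⁻¹, σ ϖ])
    {g : Matrix (Fin 2) (Fin 2) K} (h10 : g 1 0 = 0) :
    (d : Matrix (Fin 2) (Fin 2) K) * g * ((d⁻¹ : GL (Fin 2) K) : Matrix (Fin 2) (Fin 2) K) = !![g 0 0, ϖ * σ ϖ * g 0 1; 0, g 1 1] := by
  have hσϖ : σ ϖ ≠ 0 := (map_ne_zero σ).2 hϖ
  have hd'' : ((d⁻¹ : GL (Fin 2) K) : Matrix (Fin 2) (Fin 2) K) = Matrix.diagonal ![ϖ⁻¹, ((σ ϖ)⁻¹)⁻¹] := by rw [hd', inv_inv]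
  ext i j
  rw [diagonal₂_conj_apply hd hd'' g i j]
  fin_cases i <;> fin_cases j <;> simp [h10] <;> field_simp

end Field

/-! ## §2 Valued field level: integrality -/

section ValuedField

variable {K : Type*} [Field K] [Valued K ℤᵐ⁰] (σ : K →+* K)

/-- **`Ad d(ϖ)` improves integrality on upper-triangular matrices**: if `g` is integral with `g₁₀ = 0` and `|ϖ|, |σϖ| ≤ 1`, then `d(ϖ) g d(ϖ)⁻¹` is integral (its entries
are `g₀₀, ϖσϖ·g₀₁, 0, g₁₁`). [cite: Rogawski1990, §3.9 p. 32] -/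
theorem isIntMatrix_torusEltTwo_conj_of_apply_one_zero_eq_zero {ϖ : K} (hϖ : ϖ ≠ 0) (hvϖ : Valued.v ϖ ≤ 1) (hvσϖ : Valued.v (σ ϖ) ≤ 1)
    {d : GL (Fin 2) K} (hd : (d : Matrix (Fin 2) (Fin 2) K) = Matrix.diagonal ![ϖ, (σ ϖ)⁻¹])
    (hd' : ((d⁻¹ : GL (Fin 2) K) : Matrix (Fin 2) (Fin 2) K) = Matrix.diagonal ![ϖ⁻¹, σ ϖ])
    {g : Matrix (Fin 2) (Fin 2) K} (hg : IsIntMatrix g) (h10 : g 1 0 = 0) :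
    IsIntMatrix ((d : Matrix (Fin 2) (Fin 2) K) * g * ((d⁻¹ : GL (Fin 2) K) : Matrix (Fin 2) (Fin 2) K)) := by
  rw [torusEltTwo_conj_eq_of_apply_one_zero_eq_zero σ hϖ hd hd' h10]
  have hmul : ∀ {x y : K}, Valued.v x ≤ 1 → Valued.v y ≤ 1 → Valued.v (x * y) ≤ 1 := fun hx hy => by
    rw [map_mul]; exact mul_le_one' hx hy
  intro i j
  fin_cases i <;> fin_cases j
  · exact hg 0 0
  · exact hmul (hmul hvϖ hvσϖ) (hg 0 1)
  · simp
  · exact hg 1 1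

omit σ in
/-- `n(s) = !![1, s; 0, 1]` is an integral matrix when `|s| ≤ 1`. [cite: PlatonovRapinchuk1994, §3.3] -/
theorem isIntMatrix_lineUnipotent {s : K} (hs : Valued.v s ≤ 1) {u : GL (Fin 2) K} (hu : (u : Matrix (Fin 2) (Fin 2) K) = !![1, s; 0, 1]) :
    IsIntMatrix (u : Matrix (Fin 2) (Fin 2) K) := by
  rw [hu]
  intro i j
  fin_cases i <;> fin_cases j <;> simp [hs]

end ValuedField

end Literature.NumberTheory.Automorphic.UnitaryGroup

end
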